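import Summits.ResolutionOfSingularities.ResolutionOfSingularities.Theorems.EquisingularLiftEquisingularLiftNatBlowupChartPointInjective
import Literature.AlgebraicGeometry.Resolution.BlowupSNC
import HarnessLib

/-!
# [OURS · L1 W4.5(b) · EL♮(3)] HSUB(ReachTC⁺)₃ brick `inv_base`, part B6b-supp (T-AXIS-SUPPORT): the cone point is the ONLY
# point of the axis `V(E ⊔ St L₁ ⊔ St L₂)` over the centre point / on the special fibre

Crux chain w45b (cell `res-hironaka`, slot W4.5(b)), working crux **EL♮** = stmt-ResolutionOfSingularities-20038, child **EL♮(3)** =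
stmt-ResolutionOfSingularities-20148, route EquisingularLift, line `sections`, registered stub `stub_elnat_tcPlusPointResolution`;
assembly HSUB(ReachTC⁺)₃ (driver p526242, INV DEFS v3 p532383), brick `inv_base` (res-type-100), sub-brick B6b ★ T-AXIS-SECTION
(res-D-pv-051, `exists_axisSection`): its binder `hsupp` — «the cone point `p_c = j₂ y′` is the only point of the support of the
axis ideal `C_axis := (E ⊔ St L₁) ⊔ St L₂` on the special fibre» — is supplied here (res-D-pv-029, T-AXIS-SUPPORT, 2026-08-27).
HONEST FRAMING: OURS; NOT a statement of H. Hironaka's manuscript or of any paper; Stacks 0804 bookkeeping on the charts of a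
blowing up; AI-written kernel lemma, weaker than expert review. No `sorry`; standard axioms; DEF-FREE.
`--supports stmt-ResolutionOfSingularities-20148 --as helper`.

SETTING. `τ₁ : X₁ → X'` the blowing up along `J` (`J = s.ker`, `s : Spec O → X'` a section of `r' : X' → Spec O`), `p ∈ X'` a point
of the centre with a frame `c = (c₀, c₁, c₂)` of `J_p`, `p_c ∈ X₁` over `p` THE VERTEX POINT of the chart `c₀` (a presentation
`(𝔔₁, χ₁)` of `𝒪_{X₁,p_c}` as a localisation of `𝒪_{X',p}[J_p/c₀]` with `χ₁(c_l/c₀) ∈ 𝔪_{p_c}`, `l = 1, 2` — the output of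
res-type-100's B6a `exists_conePoint_presentation`, p541628), and two ideal sheaves `L₁, L₂` on `X'` with `(L_l)_p = (c_l)` (the
prescribed-germ divisors of `c₁, c₂`, p534222). The AXIS ideal is `C_axis := (J·𝒪_{X₁} ⊔ St L₁) ⊔ St L₂` (`St` = schematic strict
transform `strictTransformIdeal τ₁ J`).

WHAT (namespace `…Cruxes.EquisingularLiftNat.Sections`):
* `stalkIdeal_strictTransformIdeal_eq_top_of_stalkIdeal_comap_le` — if the exceptional stalk `(J·𝒪)_{x'}` lies in the total
  transform stalk `(K·𝒪)_{x'}`, the strict transform of `V(K)` misses `x'`: `(St K)_{x'} = ⊤` (the stalk of the strict transform is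
  the saturation `⋃ₙ ((K·𝒪)_{x'} : (J·𝒪)_{x'}ⁿ)`, tree `stalkIdeal_strictTransformIdeal`, and `1 ∈ ((K·𝒪) : (J·𝒪))`);
  `not_mem_support_strictTransformIdeal_of_stalkIdeal_comap_le`, `not_mem_support_strictTransformIdeal_of_generator` (the case
  `(J·𝒪)_{z} = (τ♯ g)` with `g ∈ K_{τ z}`: a hypersurface through the centre whose local equation generates the exceptional stalk
  at `z` has no strict transform through `z`).
* **`eq_conePoint_of_mem_support_axis`** — every point `z` of `supp C_axis` over `p` IS the vertex point `p_c`: otherwise some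
  `c_l`, `l ≠ 0`, generates the exceptional stalk at `z` (res-L1-w45b-stub-2's `exists_generator_ne_of_ne_vertex`, p540294 — the
  vertex point of a chart is unique, Stacks 0804), and then `z ∉ supp St L_l`.
* **`eq_conePoint_of_mem_support_axis_of_apply_eq_closedPoint`** — the `hsupp` binder of res-D-pv-051's `exists_axisSection`
  verbatim (`f := τ₁ ≫ r'`, `C := (s.ker.comap τ₁ ⊔ St L₁) ⊔ St L₂`): a point of `supp C_axis` on the special fibre lies over a
  point of `supp s.ker = s(Spec O)` over the closed point, i.e. over `p = s(s₀)` (`s` is a closed immersion, being a section of the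
  separated `r'`), hence is `p_c`.

References: The Stacks Project, Tags 0804, 0806; Görtz–Wedhorn, Algebraic Geometry I, (13.19); tree `BlowupSNC.lean`
(`stalkIdeal_strictTransformIdeal`), p540294 (…NatBlowupChartPointInjective), p541628 (…NatConePointPresentation).
-/

set_option linter.dupNamespace false -- mandated namespace `Summit.<Summit>.<Problem>` of this single-conjunct summit

noncomputable section

open CategoryTheory CategoryTheory.Limits AlgebraicGeometry TopologicalSpace IsLocalRing
open Literature.AlgebraicGeometry.Resolution
open AlgebraicGeometry.Scheme.IdealSheafData

namespace Summit.ResolutionOfSingularities.ResolutionOfSingularities.Cruxes.EquisingularLiftNat.Sections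

universe u

/-! ## 1. A hypersurface through the centre whose equation generates the exceptional stalk has no strict transform there -/

section General

variable {X' X : Scheme.{u}} {π : X' ⟶ X} {J : X.IdealSheafData}

/-- **If the exceptional stalk lies in the total-transform stalk, the strict transform is trivial at the point**: for `X'` locally
Noetherian, `π : X' → X`, ideal sheaves `J` (centre) and `K` on `X` and `x' ∈ X'` with `(J·𝒪_{X'})_{x'} ⊆ (K·𝒪_{X'})_{x'}`, the
stalk of `strictTransformIdeal π J K` at `x'` is `⊤` (it is the saturation `⋃ₙ ((K·𝒪)_{x'} : (J·𝒪)_{x'}ⁿ)`, whose `n = 1` term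
contains `1`). [cite: GortzWedhorn2020, (13.19) p. 414] -/
theorem stalkIdeal_strictTransformIdeal_eq_top_of_stalkIdeal_comap_le [IsLocallyNoetherian X'] (K : X.IdealSheafData)
    (x' : X') (h : stalkIdeal (J.comap π) x' ≤ stalkIdeal (K.comap π) x') :
    stalkIdeal (strictTransformIdeal π J K) x' = ⊤ := by
  rw [stalkIdeal_strictTransformIdeal π J K x', eq_top_iff]
  refine le_trans ?_ (le_iSup _ 1)
  intro r _
  rw [Submodule.mem_colon]
  intro y hy
  rw [pow_one, SetLike.mem_coe] at hy
  rw [← stalkIdeal_comap_eq_map_stalkMap, smul_eq_mul]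
  exact Ideal.mul_mem_left _ r (h hy)

/-- Under the hypothesis of `stalkIdeal_strictTransformIdeal_eq_top_of_stalkIdeal_comap_le`, `x'` is not in the support of the
strict transform. [cite: GortzWedhorn2020, (13.19) p. 414] -/
theorem not_mem_support_strictTransformIdeal_of_stalkIdeal_comap_le [IsLocallyNoetherian X'] (K : X.IdealSheafData)
    (x' : X') (h : stalkIdeal (J.comap π) x' ≤ stalkIdeal (K.comap π) x') :
    x' ∉ (strictTransformIdeal π J K).support := by
  rw [mem_support_iff_stalkIdeal_le, stalkIdeal_strictTransformIdeal_eq_top_of_stalkIdeal_comap_le K x' h, top_le_iff]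
  exact (maximalIdeal.isMaximal _).ne_top

/-- **A hypersurface through the centre whose local equation generates the exceptional stalk at `z` has no strict transform
through `z`**: if `g ∈ K_{π z}` and `(J·𝒪_{X'})_z = (π♯ g)`, then `z ∉ supp (strictTransformIdeal π J K)`.
[cite: GortzWedhorn2020, (13.19) p. 414] -/
theorem not_mem_support_strictTransformIdeal_of_generator [IsLocallyNoetherian X'] (K : X.IdealSheafData) (z : X')
    (g : X.presheaf.stalk (π z)) (hK : g ∈ stalkIdeal K (π z))
    (hE : stalkIdeal (J.comap π) z = Ideal.span {(π.stalkMap z).hom g}) :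
    z ∉ (strictTransformIdeal π J K).support := by
  refine not_mem_support_strictTransformIdeal_of_stalkIdeal_comap_le K z ?_
  rw [hE, Ideal.span_singleton_le_iff_mem, stalkIdeal_comap_eq_map_stalkMap]
  exact Ideal.mem_map_of_mem _ hK

end General

/-! ## 2. The cone point is the only point of the axis over the centre point -/

/-- **The cone point is the only point of the axis `V((J·𝒪 ⊔ St L₁) ⊔ St L₂)` over `p`.** Let `τ₁ : X₁ → X'` be the blowing up
along `J`, `p ∈ X'`, `c = (c₀, c₁, c₂)` generators of `J_p`, `p_c ∈ X₁` over `p` presented on the chart `c₀` at a prime `𝔔₁` over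
`𝔪_p` by `χ₁ ⊇ τ₁♯` with `χ₁(c_l/c₀) ∈ 𝔪_{p_c}` for `l ≠ 0` (the vertex point of the chart; res-type-100's
`exists_conePoint_presentation` output), and `L₁, L₂` ideal sheaves on `X'` with `(L_l)_p = (c_l)`. Then every point `z` over `p`
of the support of `C_axis := (J.comap τ₁ ⊔ St L₁) ⊔ St L₂` equals `p_c`: if `z ≠ p_c`, some `c_l` with `l ≠ 0` generates the
exceptional stalk at `z` (`exists_generator_ne_of_ne_vertex`), so `z ∉ supp St L_l`. [cite: StacksProject, Tag 0804] -/
theorem eq_conePoint_of_mem_support_axis {X' X₁ : Scheme.{u}} [IsLocallyNoetherian X₁] {J : X'.IdealSheafData}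
    {τ₁ : X₁ ⟶ X'} (hτ₁ : IsBlowup τ₁ J) {p : X'} (c : Fin 3 → X'.presheaf.stalk p)
    (hcJ : Ideal.span (Set.range c) = stalkIdeal J p) {pc : X₁} (hpc : τ₁ pc = p)
    (𝔔₁ : PrimeSpectrum (blowupAlgebra (Ideal.span (Set.range c)) (c 0)))
    (χ₁ : blowupAlgebra (Ideal.span (Set.range c)) (c 0) →+* X₁.presheaf.stalk pc)
    (hχ₁ : ∀ a, χ₁ (algebraMap _ _ a) = ((X'.presheaf.stalkCongr (Inseparable.of_eq hpc)).inv ≫ τ₁.stalkMap pc).hom a)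
    (hloc₁ : @IsLocalization.AtPrime _ _ (X₁.presheaf.stalk pc) _ χ₁.toAlgebra 𝔔₁.asIdeal _)
    (h𝔔₁ : 𝔔₁.asIdeal.comap (algebraMap _ (blowupAlgebra (Ideal.span (Set.range c)) (c 0))) =
      maximalIdeal (X'.presheaf.stalk p))
    (hu : ∀ l : Fin 3, l ≠ 0 → χ₁ (blowupAlgebra.frac c 0 l) ∈ maximalIdeal (X₁.presheaf.stalk pc))
    (L₁ L₂ : X'.IdealSheafData) (hL₁ : stalkIdeal L₁ p = Ideal.span {c 1}) (hL₂ : stalkIdeal L₂ p = Ideal.span {c 2})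
    {z : X₁} (hz : τ₁ z = p)
    (hzC : z ∈ ((J.comap τ₁ ⊔ strictTransformIdeal τ₁ J L₁) ⊔ strictTransformIdeal τ₁ J L₂).support) : z = pc := by
  subst hz
  by_contra hne
  have hfr : ∀ l : Fin 3, l ≠ 0 → blowupAlgebra.frac c 0 l ∈ 𝔔₁.asIdeal := fun l hl =>
    (mem_chartPrime_iff_apply_mem_maximalIdeal 𝔔₁ χ₁ hloc₁ _).mpr (hu l hl)
  obtain ⟨l, hl0, hEz⟩ := exists_generator_ne_of_ne_vertex hτ₁ hpc rfl c hcJ 0 𝔔₁ χ₁ hχ₁ hloc₁ h𝔔₁ hfr hne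
  have h0 : ∀ a, ((X'.presheaf.stalkCongr (Inseparable.of_eq (rfl : τ₁ z = τ₁ z))).inv ≫ τ₁.stalkMap z).hom a =
      (τ₁.stalkMap z).hom a := fun a => by simp [TopCat.Presheaf.stalkCongr]
  rw [h0] at hEz
  have hzC' : z ∈ (((J.comap τ₁ ⊔ strictTransformIdeal τ₁ J L₁) ⊔ strictTransformIdeal τ₁ J L₂).support : Set X₁) := hzC
  rw [support_sup, support_sup, Closeds.coe_inf, Closeds.coe_inf] at hzC'
  have hz1 : z ∈ ((strictTransformIdeal τ₁ J L₁).support : Set X₁) := hzC'.1.2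
  have hz2 : z ∈ ((strictTransformIdeal τ₁ J L₂).support : Set X₁) := hzC'.2
  have key : ∀ l : Fin 3, l ≠ 0 → stalkIdeal (J.comap τ₁) z = Ideal.span {(τ₁.stalkMap z).hom (c l)} → False := by
    intro l
    fin_cases l <;> intro hl hE
    · exact hl rfl
    · exact not_mem_support_strictTransformIdeal_of_generator L₁ z (c 1)
        (by rw [hL₁]; exact Ideal.mem_span_singleton_self _) hE hz1
    · exact not_mem_support_strictTransformIdeal_of_generator L₂ z (c 2)
        (by rw [hL₂]; exact Ideal.mem_span_singleton_self _) hE hz2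
  exact key l hl0 hEz

/-! ## 3. The `hsupp` binder of T-AXIS-SECTION: on the special fibre the axis meets only the cone point -/

/-- **On the special fibre the support of the axis is the cone point** — the binder `hsupp` of res-D-pv-051's `exists_axisSection`
(`f := τ₁ ≫ r'`, `C := (s.ker.comap τ₁ ⊔ St L₁) ⊔ St L₂`). Setting: `O` local, `r' : X' → Spec O` separated with a section `s`
(hence a closed immersion), `τ₁ : X₁ → X'` the blowing up along `s.ker`, `p = s(s₀)`, frame / vertex-point presentation / `L₁, L₂`
as in `eq_conePoint_of_mem_support_axis`. A point `z ∈ supp C` with `r'(τ₁ z) = s₀` lies over a point of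
`supp s.ker = s(Spec O)` over `s₀`, i.e. over `p`; conclude by `eq_conePoint_of_mem_support_axis`.
[cite: StacksProject, Tag 0804] -/
theorem eq_conePoint_of_mem_support_axis_of_apply_eq_closedPoint {O : Type} [CommRing O] [IsLocalRing O]
    {X' X₁ : Scheme.{0}} [IsLocallyNoetherian X₁] (r' : X' ⟶ Spec (.of O)) [IsSeparated r']
    (s : Spec (.of O) ⟶ X') (hs : s ≫ r' = 𝟙 _) {τ₁ : X₁ ⟶ X'} (hτ₁ : IsBlowup τ₁ s.ker)
    {p : X'} (hsp : s (closedPoint O) = p) (c : Fin 3 → X'.presheaf.stalk p)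
    (hcJ : Ideal.span (Set.range c) = stalkIdeal s.ker p) {pc : X₁} (hpc : τ₁ pc = p)
    (𝔔₁ : PrimeSpectrum (blowupAlgebra (Ideal.span (Set.range c)) (c 0)))
    (χ₁ : blowupAlgebra (Ideal.span (Set.range c)) (c 0) →+* X₁.presheaf.stalk pc)
    (hχ₁ : ∀ a, χ₁ (algebraMap _ _ a) = ((X'.presheaf.stalkCongr (Inseparable.of_eq hpc)).inv ≫ τ₁.stalkMap pc).hom a)
    (hloc₁ : @IsLocalization.AtPrime _ _ (X₁.presheaf.stalk pc) _ χ₁.toAlgebra 𝔔₁.asIdeal _)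
    (h𝔔₁ : 𝔔₁.asIdeal.comap (algebraMap _ (blowupAlgebra (Ideal.span (Set.range c)) (c 0))) =
      maximalIdeal (X'.presheaf.stalk p))
    (hu : ∀ l : Fin 3, l ≠ 0 → χ₁ (blowupAlgebra.frac c 0 l) ∈ maximalIdeal (X₁.presheaf.stalk pc))
    (L₁ L₂ : X'.IdealSheafData) (hL₁ : stalkIdeal L₁ p = Ideal.span {c 1}) (hL₂ : stalkIdeal L₂ p = Ideal.span {c 2}) :
    ∀ z ∈ ((s.ker.comap τ₁ ⊔ strictTransformIdeal τ₁ s.ker L₁) ⊔ strictTransformIdeal τ₁ s.ker L₂).support,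
      (τ₁ ≫ r') z = closedPoint O → z = pc := by
  intro z hzC hz0
  haveI : IsClosedImmersion (s ≫ r') := by rw [hs]; infer_instance
  haveI : IsClosedImmersion s := .of_comp s r'
  -- `τ₁ z ∈ supp s.ker = s(Spec O)`
  have hzE : τ₁ z ∈ (s.ker.support : Set X') := by
    have hzC' : z ∈ (((s.ker.comap τ₁ ⊔ strictTransformIdeal τ₁ s.ker L₁) ⊔ strictTransformIdeal τ₁ s.ker L₂).support :
      Set X₁) := hzC
    rw [support_sup, support_sup, Closeds.coe_inf, Closeds.coe_inf, support_comap, Closeds.coe_preimage] at hzC'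
    exact hzC'.1.1
  rw [Scheme.Hom.support_ker, s.isClosedEmbedding.isClosed_range.closure_eq] at hzE
  obtain ⟨t, ht⟩ := hzE
  -- `t = r'(s t) = r'(τ₁ z) = s₀`
  have h1 : r' (s t) = t := by
    rw [← Scheme.Hom.comp_apply, hs]; rfl
  have htr : t = closedPoint O := by
    rw [← h1, ht, ← Scheme.Hom.comp_apply]; exact hz0
  have hz : τ₁ z = p := by rw [← ht, htr, hsp]
  exact eq_conePoint_of_mem_support_axis hτ₁ c hcJ hpc 𝔔₁ χ₁ hχ₁ hloc₁ h𝔔₁ hu L₁ L₂ hL₁ hL₂ hz hzC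

end Summit.ResolutionOfSingularities.ResolutionOfSingularities.Cruxes.EquisingularLiftNat.Sections

end
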